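import Literature.Geometry.Kaehler.ComplexTorusAnalyticClasses
import Literature.Geometry.Kaehler.ComplexTorusAnalyticCycleIntersectionNonneg
import Literature.Geometry.Kaehler.ComplexTorusZuckerPeriods
import Literature.Geometry.Kaehler.ComplexTorusProductL2
import Literature.Geometry.Kaehler.ComplexTorusRationalFormsBasis
import HarnessLib

/-!
# Zucker's Theorem for the explicit general `J`-torus `T₀ = ℂ²/L₀`: no analytic curves, `A¹(T₀) = 0 ≠ B¹(T₀)`

S. Zucker, *The Hodge conjecture for cubic fourfolds*, Compositio Math. 34 (1977), Appendix B
("Complex tori with non-analytic rational cohomology of type `(p, p)`"), THEOREM p. 208 for `n = 1`: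
the general `J`-torus `T = (ℂ ⊕ ℂ)/L`, `JL = L`, "contains no analytic subvarieties of dimension `n`",
while `H^{n,n}(T) ∩ H^{2n}(T, ℚ)` has rank two — "so the analogue of the Hodge conjecture for Kähler
manifolds is false; in fact even the Lefschetz theorem for divisors is false on general Kähler manifolds".
Zucker's proof (p. 208): `J^*β = -β` for every `β ∈ H^{n,n}(T, ℤ)` (Proposition p. 207), so an effective
analytic cycle `Z` with class `β` would give the effective cycle `Z + J⁻¹Z` homologous to zero, and
"no effective analytic cycle can be homologous to zero on a compact Kähler manifold".

This file proves the Theorem for the EXPLICIT general `J`-torus of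
`ComplexTorusZuckerLattice.lean` / `ComplexTorusZuckerPeriods.lean`: `T₀ = ℂ²/L₀`,
`L₀ = ℤv₁ ⊕ ℤv₂ ⊕ ℤJv₁ ⊕ ℤJv₂`, `v₁ = (1, 1)`, `v₂ = (√2, √3)` (period isomorphism `Zucker.skewPeriodCLE`),
in the language of the tree's analytic sets and cycle classes (rows A2/A4 of lane `lit-hodgefound`):

* §0 `Zucker.toL2`, **`Zucker.skewPeriodL2`** — the same lattice presented in the Euclidean model
  `EuclideanSpace ℂ (Fin 2)` of `ℂ²` (the cycle-class files need an `InnerProductSpace ℂ` model; the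
  sup-normed `Fin 2 → ℂ` of `skewPeriodCLE` is not one); the two presentations have the same underlying
  torus and the change of presentation `ρ(1)` is biholomorphic (`Zucker.presentationHomeomorph`).
* §1 multilinear bookkeeping for `ℂ`-valued `2`-forms and the real frame
  `f₀ = (1,0)`, `f₁ = (i,0) = if₀`, `f₂ = (0,1)`, `f₃ = (0,i) = if₂` of `ℂ²`, in which
  `v₁ = f₀ + f₂`, `v₂ = √2f₀ + √3f₂`, `Jv₁ = f₁ - f₃`, `Jv₂ = √2f₁ - √3f₃`.
* §2 **Zucker's Proposition on the COHOMOLOGY side** (`Zucker.apply_frame_eq_zero_of_rational`): a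
  rational `2`-form of type `(1,1)` on `T₀` has no
  `dz ∧ dz̄` and no `dw ∧ dw̄` component, `γ(f₀, f₁) = γ(f₂, f₃) = 0` — the periods
  `γ(v₁, Jv₁) = a - b`, `γ(v₂, Jv₂) = 2a - 3b`, `γ(v₁, Jv₂) + γ(v₂, Jv₁) = 2√2a - 2√3b` (`a = γ(f₀,f₁)`,
  `b = γ(f₂,f₃)`) are rational only for `a = b = 0`, by the `ℚ`-linear independence of `1, √2, √3`
  (`Zucker.eq_zero_of_rat_mul_sqrt_two_sub_rat_mul_sqrt_three`; Zucker: "if `ab⁻¹` is transcendental …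
  satisfied by no non-trivial `4`-tuple of integers" — here an explicit algebraic substitute, as in
  `ComplexTorusZuckerPeriods`). Hence such a form is `J`-ANTI-INVARIANT in the sense that it lives on
  `ℝ Re(dz ∧ dw̄) ⊕ ℝ Im(dz ∧ dw̄)`.
* §3 **`Zucker.eq_zero_of_rational_of_nonneg`**, **`Zucker.eq_zero_of_mem_integralHodgeClasses_of_nonneg`**
  (and `…_mem_hodgeClasses_…`): an integral (or rational) class of type `(1,1)` on `T₀` which is
  non-negative on all complex lines (`γ(v, iv) ≥ 0`) vanishes (the remaining coefficients are
  killed by the four test vectors `f₀ ± f₂`, `f₁ + f₂`, `f₀ + f₃`). This is the cohomological content of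
  "no effective analytic cycle can be homologous to zero": by Lelong's theorem the class of an analytic
  curve IS non-negative on complex lines and non-zero (tree, rows A2-113/A4:
  `analyticCycleClass_apply_complexFrame_nonneg_of_orientationSign_eq_one`, `analyticCycleClass_ne_zero`).
* §4 **ZUCKER'S THEOREM for `T₀`**: `Zucker.not_hasPureDim_one_skewPeriodL2` and, transported to the
  original presentation, **`Zucker.not_hasPureDim_one`** / `Zucker.not_hasPureCodim_one` —
  `T₀ = ComplexTorus Zucker.skewPeriodCLE` contains NO closed analytic subset of pure dimension one
  (equivalently of pure codimension one): no analytic curve; this is the geometric leaf `h₂` of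
  `Literature.Barriers.HodgeConjecture.Zucker1977_kaehlerTorus_noAnalyticCycles_of_skewLattice`.
* §5 In the language of row A4-104 (`analyticClasses` = Voisin's `Hdg^{2k}(X)_{an}`, Lange's algebraic
  classes): **`Zucker.analyticClasses_one_eq_bot`**, `Zucker.analyticClassesInt_one_eq_bot` (`A¹(T₀) = 0`,
  over `ℚ` and `ℤ`), the explicit non-zero rational `(1,1)`-class `Zucker.xiForm = (√3 - √2)⁻¹ · 2Re(dz ∧ dw̄)`
  (`xiForm_single`: periods `((0,2,0,0),(-2,0,0,0),(0,0,0,-2),(0,0,2,0))`; `xiForm_mem_hodgeClasses`,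
  `xiForm_ne_zero`; Mumford's class `ξ` of Zucker's Lemma p. 207, renormalised to rational periods), hence
  `Zucker.hodgeClasses_one_ne_bot` and **`Zucker.analyticClasses_one_ne_hodgeClasses`: `A¹(T₀) ≠ B¹(T₀)`**
  (`analyticClasses_one_lt_hodgeClasses`, `xiForm_not_mem_analyticClasses`) —
  the cycle-class form of Lefschetz `(1,1)` / of the Hodge conjecture FAILS for this compact Kähler
  (non-projective) surface, while it holds for every `2`-dimensional ABELIAN VARIETY
  (`IsAbelianVariety.analyticClasses_eq_hodgeClasses_of_finrank_le_two`, row A4-104 rider).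

* §6 (appended, skel-4 gen 42) **ZUCKER'S PROPOSITION IN FULL on the cohomology side**: Mumford's second class
  `Zucker.etaForm = 2(√3 - √2)⁻¹ Im(dz ∧ dw̄)` (`etaForm_single`: periods `((0,0,0,2),(0,0,-2,0),(0,2,0,0),(-2,0,0,0))`,
  `etaForm_mem_hodgeClasses`), `eq_zero_of_mem_hodgeClasses_of_periods` (a Hodge class is determined by its
  periods over `v₁ ∧ v₂` and `v₁ ∧ Jv₂`), **`hodgeClasses_one_eq_span`: `H^{1,1}(T₀) ∩ H²(T₀, ℚ) = ℚ ξ' ⊕ ℚ η'`**,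
  `linearIndependent_xiForm_etaForm`, **`finrank_hodgeClasses_one : dim_ℚ B¹(T₀) = 2`** ("the two classes
  `ξ` and `η` generate `H^{n,n}(T, ℤ)`" — here over `ℚ`); Zucker's operator `Zucker.JL` on the Euclidean model
  (`skewPeriodL2_mulVec`: it is the analytic representation of the automorphism `ρ(squareMatrix)`), `xiForm_JL`,
  `etaForm_JL` and **`apply_JL_of_mem_hodgeClasses`: `J^*β = -β` for every `β ∈ B¹(T₀)`** — Zucker's mechanism
  on the cohomology side (the homology side is `Zucker.skew_latticePairing_comp_J`).

Definitions `toL2`, `skewPeriodL2`, `presentationHomeomorph`, `frame`, `dzL`, `dzbarL`, `xiForm`, `etaForm`, `JL`;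
theorems otherwise; no named fact, no instance, no notation. Discharge of the barrier fact is the sibling
`Literature/Barriers/HodgeConjecture/KaehlerCounterexamplesHolds.lean`.

## References

* [Zucker1977] S. Zucker, The Hodge conjecture for cubic fourfolds, Compositio Math. 34 (1977) 199–209,
  Appendix B, Lemma and Proposition p. 207, Theorem p. 208.
* [Voisin2002KaehlerCounterexample] C. Voisin, A counterexample to the Hodge conjecture extended to Kähler
  varieties, IMRN 2002 no. 20, §1 ("If the torus is chosen general enough, it will not contain any analytic
  hypersurface").
* [VoisinHodgeI2002] C. Voisin, Hodge Theory and Complex Algebraic Geometry I (2002), §11.3.1 (analytic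
  classes `Hdg^{2k}(X)_{an}`), Thm. 11.33.
* [GriffithsHarrisPrinciples1978] P. Griffiths, J. Harris, Principles of Algebraic Geometry (1978), Ch. 0 §2
  (Wirtinger: positivity of analytic subvarieties), Ch. 3 §1 (Lelong).
-/

noncomputable section

open scoped Manifold ComplexOrder ComplexConjugate
open Complex Module Set Function
open Literature.Analysis.Complex (IsOfTypeAt)

namespace Literature.Geometry.Kaehler

namespace Zucker

open ComplexTorus

/-! ### §0 The Euclidean-model presentation of `T₀` -/

/-- The identification of the sup-normed model `Fin 2 → ℂ` of `ℂ²` with the Euclidean model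
`EuclideanSpace ℂ (Fin 2)` (same vectors, Hilbert norm), a `ℂ`-linear homeomorphism. [folklore] -/
def toL2 : (Fin 2 → ℂ) ≃L[ℂ] EuclideanSpace ℂ (Fin 2) := (EuclideanSpace.equiv (Fin 2) ℂ).symm

/-- `toL2` is the identity on vectors: `(toL2 u) a = u a`. [folklore] -/
@[simp] private theorem toL2_apply (u : Fin 2 → ℂ) (a : Fin 2) : toL2 u a = u a := rfl

/-- `toL2.symm` is the identity on vectors. [folklore] -/
@[simp] private theorem toL2_symm_apply (u : EuclideanSpace ℂ (Fin 2)) (a : Fin 2) : toL2.symm u a = u a := rfl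

/-- **The skew `J`-lattice `L₀` in the Euclidean model of `ℂ²`**: the period isomorphism
`x ↦ x₀v₁ + x₁v₂ + x₂Jv₁ + x₃Jv₂` of `ComplexTorusZuckerLattice` followed by `toL2`. The torus
`ComplexTorus skewPeriodL2` has the same points as `T₀ = ComplexTorus skewPeriodCLE` and the identity
between them is biholomorphic (`presentationHomeomorph`). [cite: Zucker1977, Appendix B p. 207] -/
def skewPeriodL2 : (Fin 4 → ℝ) ≃L[ℝ] EuclideanSpace ℂ (Fin 2) :=
  (skewPeriod.trans (toL2.toLinearEquiv.restrictScalars ℝ)).toContinuousLinearEquiv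

/-- `skewPeriodL2 x = toL2 (skewPeriod x)`. [cite: Zucker1977, Appendix B p. 207] -/
@[simp] theorem skewPeriodL2_apply (x : Fin 4 → ℝ) : skewPeriodL2 x = toL2 (skewPeriod x) := rfl

/-- The change of presentation `ρ(1)` from the Euclidean to the sup model has `ℂ`-linear analytic
representation `toL2⁻¹`. [cite: Lange2023AbelianVarietiesComplex, §1.1.2 Lemma 1.1.11] -/
theorem skewPeriodCLE_one_mulVec (x : Fin 4 → ℝ) :
    skewPeriodCLE (((1 : Matrix (Fin 4) (Fin 4) ℤ).map (Int.cast : ℤ → ℝ)).mulVec x) =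
      (toL2.symm : EuclideanSpace ℂ (Fin 2) →L[ℂ] (Fin 2 → ℂ)) (skewPeriodL2 x) := by
  rw [Matrix.map_one Int.cast Int.cast_zero Int.cast_one, Matrix.one_mulVec]
  rfl

/-- … and `ρ(1)` from the sup to the Euclidean model has analytic representation `toL2`.
[cite: Lange2023AbelianVarietiesComplex, §1.1.2 Lemma 1.1.11] -/
theorem skewPeriodL2_one_mulVec (x : Fin 4 → ℝ) :
    skewPeriodL2 (((1 : Matrix (Fin 4) (Fin 4) ℤ).map (Int.cast : ℤ → ℝ)).mulVec x) =
      (toL2 : (Fin 2 → ℂ) →L[ℂ] EuclideanSpace ℂ (Fin 2)) (skewPeriodCLE x) := by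
  rw [Matrix.map_one Int.cast Int.cast_zero Int.cast_one, Matrix.one_mulVec]
  rfl

/-- **The two presentations of `T₀` are biholomorphic**: the change of presentation `ρ(1)` (the identity
on the points `(ℝ/ℤ)⁴`) as a homeomorphism `ComplexTorus skewPeriodL2 ≃ₜ ComplexTorus skewPeriodCLE`;
it is holomorphic in both directions (`mdifferentiable_presentationHomeomorph`, `…_symm`).
[cite: Lange2023AbelianVarietiesComplex, §1.1.2 Lemma 1.1.11] -/
def presentationHomeomorph : ComplexTorus skewPeriodL2 ≃ₜ ComplexTorus skewPeriodCLE where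
  toFun := mapMatrix skewPeriodL2 skewPeriodCLE (1 : Matrix (Fin 4) (Fin 4) ℤ)
  invFun := mapMatrix skewPeriodCLE skewPeriodL2 (1 : Matrix (Fin 4) (Fin 4) ℤ)
  left_inv x := by rw [mapMatrix_one_eq, mapMatrix_one_eq]
  right_inv x := by rw [mapMatrix_one_eq, mapMatrix_one_eq]
  continuous_toFun := (contMDiff_real_mapMatrix (n := 0) (1 : Matrix (Fin 4) (Fin 4) ℤ)).continuous
  continuous_invFun := (contMDiff_real_mapMatrix (n := 0) (1 : Matrix (Fin 4) (Fin 4) ℤ)).continuous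

/-- The change of presentation is holomorphic. [cite: Lange2023AbelianVarietiesComplex, §1.1.2 Lemma 1.1.11] -/
theorem mdifferentiable_presentationHomeomorph :
    MDifferentiable 𝓘(ℂ, EuclideanSpace ℂ (Fin 2)) 𝓘(ℂ, Fin 2 → ℂ) presentationHomeomorph :=
  (contMDiff_mapMatrix (n := 1) (toL2.symm : EuclideanSpace ℂ (Fin 2) →L[ℂ] (Fin 2 → ℂ))
    skewPeriodCLE_one_mulVec).mdifferentiable one_ne_zero

/-- … with holomorphic inverse. [cite: Lange2023AbelianVarietiesComplex, §1.1.2 Lemma 1.1.11] -/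
theorem mdifferentiable_presentationHomeomorph_symm :
    MDifferentiable 𝓘(ℂ, Fin 2 → ℂ) 𝓘(ℂ, EuclideanSpace ℂ (Fin 2)) presentationHomeomorph.symm :=
  (contMDiff_mapMatrix (n := 1) (toL2 : (Fin 2 → ℂ) →L[ℂ] EuclideanSpace ℂ (Fin 2))
    skewPeriodL2_one_mulVec).mdifferentiable one_ne_zero

/-- The two models of `ℂ²` have the same dimension. [folklore] -/
private theorem finrank_euclideanSpace_eq : finrank ℂ (EuclideanSpace ℂ (Fin 2)) = finrank ℂ (Fin 2 → ℂ) :=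
  toL2.symm.toLinearEquiv.finrank_eq

/-- `dim_ℂ EuclideanSpace ℂ (Fin 2) = 2`. [folklore] -/
private theorem finrank_euclideanSpace_fin_two : finrank ℂ (EuclideanSpace ℂ (Fin 2)) = 2 := by
  rw [finrank_euclideanSpace_eq]; simp

/-! ### §1 `ℂ`-valued `2`-forms: multilinear bookkeeping, and the real frame `f₀, f₁, f₂, f₃` of `ℂ²` -/

section TwoForm

variable {V : Type*} [NormedAddCommGroup V] [NormedSpace ℝ V]

/-- Antisymmetry `γ(x, y) = -γ(y, x)`. [folklore] -/
private theorem ctf_swap (γ : V [⋀^Fin 2]→L[ℝ] ℂ) (x y : V) : γ ![x, y] = -γ ![y, x] := by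
  have h := γ.toAlternatingMap.map_swap ![y, x] (show (0 : Fin 2) ≠ 1 by decide)
  have e : (![y, x] ∘ Equiv.swap (0 : Fin 2) 1) = ![x, y] := by
    funext i; fin_cases i <;> rfl
  rw [e] at h
  exact h

/-- `γ(x, x) = 0`. [folklore] -/
private theorem ctf_self (γ : V [⋀^Fin 2]→L[ℝ] ℂ) (x : V) : γ ![x, x] = 0 :=
  γ.toAlternatingMap.map_eq_zero_of_eq ![x, x] (show ![x, x] (0 : Fin 2) = ![x, x] 1 from rfl)
    (show (0 : Fin 2) ≠ 1 by decide)

/-- Additivity in the first slot. [folklore] -/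
private theorem ctf_add_left (γ : V [⋀^Fin 2]→L[ℝ] ℂ) (x y w : V) : γ ![x + y, w] = γ ![x, w] + γ ![y, w] :=
  γ.vecCons_add ![w] x y

/-- Real homogeneity in the first slot. [folklore] -/
private theorem ctf_smul_left (γ : V [⋀^Fin 2]→L[ℝ] ℂ) (c : ℝ) (x w : V) : γ ![c • x, w] = (c : ℂ) * γ ![x, w] := by
  rw [show γ ![c • x, w] = c • γ ![x, w] from γ.vecCons_smul ![w] c x, Complex.real_smul]

/-- Additivity in the second slot. [folklore] -/
private theorem ctf_add_right (γ : V [⋀^Fin 2]→L[ℝ] ℂ) (w x y : V) : γ ![w, x + y] = γ ![w, x] + γ ![w, y] := by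
  rw [ctf_swap γ w, ctf_add_left, ctf_swap γ x, ctf_swap γ y]; ring

/-- Real homogeneity in the second slot. [folklore] -/
private theorem ctf_smul_right (γ : V [⋀^Fin 2]→L[ℝ] ℂ) (c : ℝ) (w x : V) : γ ![w, c • x] = (c : ℂ) * γ ![w, x] := by
  rw [ctf_swap γ w, ctf_smul_left, ctf_swap γ x]; ring

/-- `γ(-x, w) = -γ(x, w)`. [folklore] -/
private theorem ctf_neg_left (γ : V [⋀^Fin 2]→L[ℝ] ℂ) (x w : V) : γ ![-x, w] = -γ ![x, w] := by
  rw [← neg_one_smul ℝ x, ctf_smul_left]; push_cast; ring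

/-- `γ(w, -x) = -γ(w, x)`. [folklore] -/
private theorem ctf_neg_right (γ : V [⋀^Fin 2]→L[ℝ] ℂ) (w x : V) : γ ![w, -x] = -γ ![w, x] := by
  rw [← neg_one_smul ℝ x, ctf_smul_right]; push_cast; ring

/-- `γ(x - y, w) = γ(x, w) - γ(y, w)`. [folklore] -/
private theorem ctf_sub_left (γ : V [⋀^Fin 2]→L[ℝ] ℂ) (x y w : V) : γ ![x - y, w] = γ ![x, w] - γ ![y, w] := by
  rw [sub_eq_add_neg, ctf_add_left, ctf_neg_left]; ring

/-- `γ(w, x - y) = γ(w, x) - γ(w, y)`. [folklore] -/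
private theorem ctf_sub_right (γ : V [⋀^Fin 2]→L[ℝ] ℂ) (w x y : V) : γ ![w, x - y] = γ ![w, x] - γ ![w, y] := by
  rw [sub_eq_add_neg, ctf_add_right, ctf_neg_right]; ring

/-- **Bilinear expansion** `γ(αx + βy, α'x' + β'y') = αα'γ(x,x') + αβ'γ(x,y') + βα'γ(y,x') + ββ'γ(y,y')`.
[folklore] -/
private theorem ctf_expand (γ : V [⋀^Fin 2]→L[ℝ] ℂ) (α β α' β' : ℝ) (x y x' y' : V) :
    γ ![α • x + β • y, α' • x' + β' • y'] =
      (α : ℂ) * α' * γ ![x, x'] + α * β' * γ ![x, y'] + β * α' * γ ![y, x'] + β * β' * γ ![y, y'] := by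
  rw [ctf_add_left, ctf_smul_left, ctf_smul_left, ctf_add_right, ctf_add_right, ctf_smul_right, ctf_smul_right,
    ctf_smul_right, ctf_smul_right]
  ring

end TwoForm

section TypeOneOne

variable {V : Type*} [NormedAddCommGroup V] [NormedSpace ℂ V]

/-- Type `(1,1)` gives `i`-invariance `γ(iu, iv) = γ(u, v)` (the case `θ = π/2` of the weight condition).
[cite: Lange2023AbelianVarietiesComplex, §1.2.2 Prop. 1.2.9] -/
theorem apply_I_smul_of_isOfTypeAt_one_one {γ : V [⋀^Fin 2]→L[ℝ] ℂ} (h : IsOfTypeAt 1 1 γ) (u v : V) :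
    γ ![I • u, I • v] = γ ![u, v] := by
  have hI : cexp (((Real.pi / 2 : ℝ) : ℂ) * I) = I := by
    rw [Complex.exp_mul_I, ← Complex.ofReal_cos, ← Complex.ofReal_sin, Real.cos_pi_div_two,
      Real.sin_pi_div_two]
    simp
  have h2 := h.2 (Real.pi / 2) ![u, v]
  have hexp : cexp ((((1 : ℕ) : ℤ) - (1 : ℕ) : ℤ) * ((Real.pi / 2 : ℝ) : ℂ) * I) = 1 := by simp
  rw [hexp, one_mul, hI] at h2
  have e : (fun i ↦ I • (![u, v] : Fin 2 → V) i) = ![I • u, I • v] := by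
    funext i; fin_cases i <;> rfl
  rw [e] at h2
  exact h2

end TypeOneOne

/-- **The real frame of `ℂ²` (Euclidean model)**: `f₀ = (1,0)`, `f₁ = (i,0)`, `f₂ = (0,1)`, `f₃ = (0,i)`.
[cite: Zucker1977, Appendix B p. 207] -/
def frame : Fin 4 → EuclideanSpace ℂ (Fin 2) :=
  ![toL2 ![1, 0], toL2 ![I, 0], toL2 ![0, 1], toL2 ![0, I]]

/-- `f₀ = (1, 0)` (coordinates of `V = ℂ ⊕ ℂ`). [cite: Zucker1977, Appendix B p. 207] -/
@[simp] theorem frame_zero : frame 0 = toL2 ![1, 0] := rfl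
/-- `f₁ = (i, 0)` (coordinates of `V = ℂ ⊕ ℂ`). [cite: Zucker1977, Appendix B p. 207] -/
@[simp] theorem frame_one : frame 1 = toL2 ![I, 0] := rfl
/-- `f₂ = (0, 1)` (coordinates of `V = ℂ ⊕ ℂ`). [cite: Zucker1977, Appendix B p. 207] -/
@[simp] theorem frame_two : frame 2 = toL2 ![0, 1] := rfl
/-- `f₃ = (0, i)` (coordinates of `V = ℂ ⊕ ℂ`). [cite: Zucker1977, Appendix B p. 207] -/
@[simp] theorem frame_three : frame 3 = toL2 ![0, I] := rfl

/-- A vector identity in the Euclidean model is one in `Fin 2 → ℂ`. [folklore] -/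
private theorem toL2_eq_iff {u : Fin 2 → ℂ} {w : EuclideanSpace ℂ (Fin 2)} : toL2 u = w ↔ u = toL2.symm w := by
  constructor
  · rintro rfl; rw [ContinuousLinearEquiv.symm_apply_apply]
  · rintro rfl; rw [ContinuousLinearEquiv.apply_symm_apply]

/-- `i f₀ = f₁`. [folklore] -/
@[simp] private theorem I_smul_frame_zero : I • frame 0 = frame 1 := by
  rw [frame_zero, frame_one, ← map_smul]; congr 1; funext a; fin_cases a <;> simp

/-- `i f₁ = -f₀`. [folklore] -/
@[simp] private theorem I_smul_frame_one : I • frame 1 = -frame 0 := by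
  rw [frame_zero, frame_one, ← map_smul, ← map_neg]; congr 1; funext a; fin_cases a <;> simp

/-- `i f₂ = f₃`. [folklore] -/
@[simp] private theorem I_smul_frame_two : I • frame 2 = frame 3 := by
  rw [frame_two, frame_three, ← map_smul]; congr 1; funext a; fin_cases a <;> simp

/-- `i f₃ = -f₂`. [folklore] -/
@[simp] private theorem I_smul_frame_three : I • frame 3 = -frame 2 := by
  rw [frame_two, frame_three, ← map_smul, ← map_neg]; congr 1; funext a; fin_cases a <;> simp

/-- Real scalars act through `ℂ` on the Euclidean model: `r • toL2 u = toL2 ((r : ℂ) • u)`. [folklore] -/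
private theorem real_smul_toL2 (r : ℝ) (u : Fin 2 → ℂ) : (r • toL2 u : EuclideanSpace ℂ (Fin 2)) = toL2 ((r : ℂ) • u) := by
  rw [map_smul, Complex.coe_smul]

/-- **The lattice basis in the frame**: `v₁ = f₀ + f₂`. [cite: Zucker1977, Appendix B p. 207] -/
theorem skewPeriodL2_single_zero : skewPeriodL2 (Pi.single 0 1) = (1 : ℝ) • frame 0 + (1 : ℝ) • frame 2 := by
  rw [skewPeriodL2_apply, skewPeriod_single_zero, one_smul, one_smul, frame_zero, frame_two, ← map_add]
  congr 1; funext a; fin_cases a <;> simp [v₁]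

/-- `v₂ = √2 f₀ + √3 f₂`. [cite: Zucker1977, Appendix B p. 207] -/
theorem skewPeriodL2_single_one :
    skewPeriodL2 (Pi.single 1 1) = Real.sqrt 2 • frame 0 + Real.sqrt 3 • frame 2 := by
  rw [skewPeriodL2_apply, skewPeriod_single_one, frame_zero, frame_two, real_smul_toL2, real_smul_toL2,
    ← map_add]
  congr 1; funext a; fin_cases a <;> simp [v₂]

/-- `Jv₁ = f₁ - f₃`, written `1 • f₁ + (-1) • f₃`. [cite: Zucker1977, Appendix B p. 207] -/
theorem skewPeriodL2_single_two :
    skewPeriodL2 (Pi.single 2 1) = (1 : ℝ) • frame 1 + (-1 : ℝ) • frame 3 := by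
  rw [skewPeriodL2_apply, skewPeriod_single_two, one_smul, neg_one_smul, frame_one, frame_three, ← map_neg,
    ← map_add]
  congr 1; funext a; fin_cases a <;> simp [v₁]

/-- `Jv₂ = √2 f₁ - √3 f₃`. [cite: Zucker1977, Appendix B p. 207] -/
theorem skewPeriodL2_single_three :
    skewPeriodL2 (Pi.single 3 1) = Real.sqrt 2 • frame 1 + (-Real.sqrt 3) • frame 3 := by
  rw [skewPeriodL2_apply, skewPeriod_single_three, frame_one, frame_three, real_smul_toL2, real_smul_toL2,
    ← map_add]
  congr 1; funext a; fin_cases a <;> simp [v₂] <;> ring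

/-- **The lattice basis in the frame, as one table**: `λ_j = α_j f_{s_j} + β_j f_{t_j}` with
`α = (1, √2, 1, √2)`, `β = (1, √3, -1, -√3)`, `s = (0, 0, 1, 1)`, `t = (2, 2, 3, 3)`. [cite: Zucker1977, Appendix B p. 207] -/
theorem skewPeriodL2_single (j : Fin 4) :
    skewPeriodL2 (Pi.single j 1) =
      (![1, Real.sqrt 2, 1, Real.sqrt 2] : Fin 4 → ℝ) j • frame ((![0, 0, 1, 1] : Fin 4 → Fin 4) j) +
        (![1, Real.sqrt 3, -1, -Real.sqrt 3] : Fin 4 → ℝ) j • frame ((![2, 2, 3, 3] : Fin 4 → Fin 4) j) := by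
  fin_cases j
  · exact skewPeriodL2_single_zero
  · exact skewPeriodL2_single_one
  · exact skewPeriodL2_single_two
  · exact skewPeriodL2_single_three

/-- A pair of frame/lattice vectors as a `Fin 2`-tuple. [folklore] -/
private theorem tuple_eq_vecCons {V : Type*} (f : Fin 4 → V) (c : Fin 2 → Fin 4) :
    (fun i ↦ f (c i)) = ![f (c 0), f (c 1)] := by
  funext i; fin_cases i <;> rfl

/-- A `2`-form on `ℂ²` vanishing on all pairs of frame vectors `(f_j, f_k)`, `j < k`, vanishes.
[folklore] -/
private theorem ctf_eq_zero_of_frame {γ : EuclideanSpace ℂ (Fin 2) [⋀^Fin 2]→L[ℝ] ℂ}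
    (h01 : γ ![frame 0, frame 1] = 0) (h02 : γ ![frame 0, frame 2] = 0) (h03 : γ ![frame 0, frame 3] = 0)
    (h12 : γ ![frame 1, frame 2] = 0) (h13 : γ ![frame 1, frame 3] = 0) (h23 : γ ![frame 2, frame 3] = 0) :
    γ = 0 := by
  -- all sixteen frame values vanish
  have hg : ∀ j k : Fin 4, γ ![frame j, frame k] = 0 := by
    intro j k
    fin_cases j <;> fin_cases k
    all_goals
      first
      | exact ctf_self γ _
      | assumption
      | (rw [ctf_swap]; simp only [neg_eq_zero]; assumption)
  -- the lattice vectors `λ_j = skewPeriodL2 (e_j)` form a real basis; expand both slots in the frame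
  have key : γ.toContinuousMultilinearMap.toMultilinearMap =
      (0 : EuclideanSpace ℂ (Fin 2) [⋀^Fin 2]→L[ℝ] ℂ).toContinuousMultilinearMap.toMultilinearMap :=
    Module.Basis.ext_multilinear (fun _ ↦ (Pi.basisFun ℝ (Fin 4)).map skewPeriodL2.toLinearEquiv) fun c ↦ by
      have e : (fun i ↦ ((Pi.basisFun ℝ (Fin 4)).map skewPeriodL2.toLinearEquiv) (c i)) =
          ![skewPeriodL2 (Pi.single (c 0) 1), skewPeriodL2 (Pi.single (c 1) 1)] := by
        funext i; fin_cases i <;> simp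
      change γ (fun i ↦ ((Pi.basisFun ℝ (Fin 4)).map skewPeriodL2.toLinearEquiv) (c i)) =
        (0 : EuclideanSpace ℂ (Fin 2) [⋀^Fin 2]→L[ℝ] ℂ) (fun i ↦ ((Pi.basisFun ℝ (Fin 4)).map skewPeriodL2.toLinearEquiv) (c i))
      rw [e, ContinuousAlternatingMap.coe_zero, Pi.zero_apply, skewPeriodL2_single (c 0), skewPeriodL2_single (c 1),
        ctf_expand, hg, hg, hg, hg]
      ring
  ext v
  exact congrArg (fun f : MultilinearMap ℝ (fun _ : Fin 2 ↦ EuclideanSpace ℂ (Fin 2)) ℂ ↦ f v) key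

/-! ### §2 Zucker's Proposition on the cohomology side: a rational `(1,1)`-form has `γ(f₀,f₁) = γ(f₂,f₃) = 0` -/

/-- **`1, √2, √3` are linearly independent over `ℚ`**: `r₁√2 - r₂√3 = q` with `r₁, r₂, q ∈ ℚ` forces
`r₁ = r₂ = 0` — the arithmetic input replacing Zucker's "`ab⁻¹` transcendental over `ℚ`" for the explicit
lattice `L₀` (companion of `Zucker.int_linearIndependent_one_sqrtAdd_sqrtMul`). [cite: Zucker1977, Appendix B Proposition p. 207] -/
theorem eq_zero_of_rat_mul_sqrt_two_sub_rat_mul_sqrt_three {r₁ r₂ q : ℚ}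
    (h : (r₁ : ℝ) * Real.sqrt 2 - r₂ * Real.sqrt 3 = q) : r₁ = 0 ∧ r₂ = 0 := by
  have h2 : Real.sqrt 2 * Real.sqrt 2 = 2 := Real.mul_self_sqrt (by norm_num)
  have h3 : Real.sqrt 3 * Real.sqrt 3 = 3 := Real.mul_self_sqrt (by norm_num)
  have hs2 : Real.sqrt 2 ≠ 0 := by positivity
  -- squaring `r₁√2 = q + r₂√3`: `2 q r₂ √3` is rational
  have hsq : 2 * (q : ℝ) * r₂ * Real.sqrt 3 = 2 * r₁ ^ 2 - q ^ 2 - 3 * r₂ ^ 2 := by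
    have e : (r₁ : ℝ) * Real.sqrt 2 = q + r₂ * Real.sqrt 3 := by linarith
    have e2 : ((r₁ : ℝ) * Real.sqrt 2) * ((r₁ : ℝ) * Real.sqrt 2) =
        ((q : ℝ) + r₂ * Real.sqrt 3) * ((q : ℝ) + r₂ * Real.sqrt 3) := by rw [e]
    have e3 : ((r₁ : ℝ) * Real.sqrt 2) * ((r₁ : ℝ) * Real.sqrt 2) = 2 * r₁ ^ 2 := by
      calc ((r₁ : ℝ) * Real.sqrt 2) * ((r₁ : ℝ) * Real.sqrt 2) = r₁ * r₁ * (Real.sqrt 2 * Real.sqrt 2) := by ring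
        _ = 2 * r₁ ^ 2 := by rw [h2]; ring
    have e4 : ((q : ℝ) + r₂ * Real.sqrt 3) * ((q : ℝ) + r₂ * Real.sqrt 3) =
        q ^ 2 + 2 * q * r₂ * Real.sqrt 3 + r₂ * r₂ * (Real.sqrt 3 * Real.sqrt 3) := by ring
    rw [e3, e4, h3] at e2
    linarith
  by_cases hqr : (q : ℝ) * r₂ = 0
  · rcases mul_eq_zero.1 hqr with hq | hr
    · -- `q = 0`: `r₁√2 = r₂√3`, so `2 r₁ = r₂ √6`
      have hq0 : (q : ℝ) = 0 := hq
      have e : (r₁ : ℝ) * Real.sqrt 2 = r₂ * Real.sqrt 3 := by linarith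
      by_cases hr2 : r₂ = 0
      · have e' : (r₁ : ℝ) * Real.sqrt 2 = 0 := by rw [e, hr2, Rat.cast_zero, zero_mul]
        exact ⟨by exact_mod_cast (mul_eq_zero.1 e').resolve_right hs2, hr2⟩
      · exfalso
        have hr2' : (r₂ : ℝ) ≠ 0 := by exact_mod_cast hr2
        have e6 : 2 * (r₁ : ℝ) = r₂ * Real.sqrt 6 := by
          calc 2 * (r₁ : ℝ) = r₁ * (Real.sqrt 2 * Real.sqrt 2) := by rw [h2]; ring
            _ = (r₁ * Real.sqrt 2) * Real.sqrt 2 := by ring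
            _ = r₂ * Real.sqrt 3 * Real.sqrt 2 := by rw [e]
            _ = r₂ * Real.sqrt 6 := by rw [mul_assoc, mul_comm (Real.sqrt 3), sqrt_two_mul_sqrt_three]
        have h6 : Real.sqrt 6 = ((2 * r₁ / r₂ : ℚ) : ℝ) := by
          push_cast
          rw [eq_div_iff hr2', mul_comm (Real.sqrt 6), e6]
        exact irrational_sqrt_six.ne_rat _ h6
    · -- `r₂ = 0`: `r₁√2 = q`
      have hr0 : r₂ = 0 := by exact_mod_cast hr
      refine ⟨?_, hr0⟩
      by_contra hr1
      have hr1' : (r₁ : ℝ) ≠ 0 := by exact_mod_cast hr1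
      have e : (r₁ : ℝ) * Real.sqrt 2 = q := by rw [hr0, Rat.cast_zero, zero_mul, sub_zero] at h; exact h
      have h2' : Real.sqrt 2 = ((q / r₁ : ℚ) : ℝ) := by
        push_cast
        rw [eq_div_iff hr1', mul_comm (Real.sqrt 2), e]
      exact irrational_sqrt_two.ne_rat _ h2'
  · -- `q r₂ ≠ 0`: `√3` would be rational
    exfalso
    have hne : 2 * (q : ℝ) * r₂ ≠ 0 := by
      intro h0; apply hqr; linarith [show (q : ℝ) * r₂ = 0 from by
        have := h0; field_simp at this ⊢; linarith]
    have h3' : Real.sqrt 3 = (((2 * r₁ ^ 2 - q ^ 2 - 3 * r₂ ^ 2) / (2 * q * r₂) : ℚ) : ℝ) := by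
      push_cast
      rw [eq_div_iff hne, mul_comm (Real.sqrt 3), hsq]
    exact irrational_sqrt_three.ne_rat _ h3'

section Proposition

variable {γ : EuclideanSpace ℂ (Fin 2) [⋀^Fin 2]→L[ℝ] ℂ}

/-- A rational form has rational periods over the basis bivectors `λ_j ∧ λ_k` of `L₀`.
[cite: Lange2023AbelianVarietiesComplex, §1.1.3 Cor. 1.1.19] -/
theorem exists_rat_eq_apply_single (hγ : γ ∈ rationalForms skewPeriodL2 2) (j k : Fin 4) :
    ∃ q : ℚ, (q : ℂ) = γ ![skewPeriodL2 (Pi.single j 1), skewPeriodL2 (Pi.single k 1)] := by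
  obtain ⟨q, hq⟩ := (mem_rationalForms_iff_forall_single skewPeriodL2).1 hγ ![j, k]
  refine ⟨q, ?_⟩
  rw [eq_ratCast] at hq
  rw [hq]
  congr 1
  funext i; fin_cases i <;> rfl

/-- The period `γ(v₁, Jv₁)` in the frame: `γ(f₀,f₁) - γ(f₀,f₃) - γ(f₁,f₂) - γ(f₂,f₃)`. [cite: Zucker1977, Appendix B p. 207] -/
theorem apply_single_zero_two :
    γ ![skewPeriodL2 (Pi.single 0 1), skewPeriodL2 (Pi.single 2 1)] =
      γ ![frame 0, frame 1] - γ ![frame 0, frame 3] - γ ![frame 1, frame 2] - γ ![frame 2, frame 3] := by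
  rw [skewPeriodL2_single_zero, skewPeriodL2_single_two, ctf_expand, ctf_swap γ (frame 2) (frame 1)]
  push_cast; ring

/-- The period `γ(v₂, Jv₂)` in the frame: `2γ(f₀,f₁) - √6(γ(f₀,f₃) + γ(f₁,f₂)) - 3γ(f₂,f₃)`. [cite: Zucker1977, Appendix B p. 207] -/
theorem apply_single_one_three :
    γ ![skewPeriodL2 (Pi.single 1 1), skewPeriodL2 (Pi.single 3 1)] =
      2 * γ ![frame 0, frame 1] - (Real.sqrt 2 * Real.sqrt 3 : ℝ) * (γ ![frame 0, frame 3] + γ ![frame 1, frame 2]) -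
        3 * γ ![frame 2, frame 3] := by
  have h2 : ((Real.sqrt 2 : ℝ) : ℂ) * (Real.sqrt 2 : ℝ) = 2 := by
    rw [← Complex.ofReal_mul, Real.mul_self_sqrt (by norm_num)]; norm_num
  have h3 : ((Real.sqrt 3 : ℝ) : ℂ) * (Real.sqrt 3 : ℝ) = 3 := by
    rw [← Complex.ofReal_mul, Real.mul_self_sqrt (by norm_num)]; norm_num
  rw [skewPeriodL2_single_one, skewPeriodL2_single_three, ctf_expand, ctf_swap γ (frame 2) (frame 1)]
  push_cast
  linear_combination (γ ![frame 0, frame 1]) * h2 - (γ ![frame 2, frame 3]) * h3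

/-- The period `γ(v₁, Jv₂)` in the frame. [cite: Zucker1977, Appendix B p. 207] -/
theorem apply_single_zero_three :
    γ ![skewPeriodL2 (Pi.single 0 1), skewPeriodL2 (Pi.single 3 1)] =
      (Real.sqrt 2 : ℝ) * γ ![frame 0, frame 1] - (Real.sqrt 3 : ℝ) * γ ![frame 0, frame 3] -
        (Real.sqrt 2 : ℝ) * γ ![frame 1, frame 2] - (Real.sqrt 3 : ℝ) * γ ![frame 2, frame 3] := by
  rw [skewPeriodL2_single_zero, skewPeriodL2_single_three, ctf_expand, ctf_swap γ (frame 2) (frame 1)]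
  push_cast; ring

/-- The period `γ(v₂, Jv₁)` in the frame. [cite: Zucker1977, Appendix B p. 207] -/
theorem apply_single_one_two :
    γ ![skewPeriodL2 (Pi.single 1 1), skewPeriodL2 (Pi.single 2 1)] =
      (Real.sqrt 2 : ℝ) * γ ![frame 0, frame 1] - (Real.sqrt 2 : ℝ) * γ ![frame 0, frame 3] -
        (Real.sqrt 3 : ℝ) * γ ![frame 1, frame 2] - (Real.sqrt 3 : ℝ) * γ ![frame 2, frame 3] := by
  rw [skewPeriodL2_single_one, skewPeriodL2_single_two, ctf_expand, ctf_swap γ (frame 2) (frame 1)]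
  push_cast; ring

/-- Type `(1,1)` in the frame: `γ(f₁, f₃) = γ(f₀, f₂)` (`= γ(if₀, if₂)`). [cite: Zucker1977, Appendix B Lemma p. 207] -/
theorem apply_frame_one_three_eq (h11 : ∀ u v : EuclideanSpace ℂ (Fin 2), γ ![I • u, I • v] = γ ![u, v]) :
    γ ![frame 1, frame 3] = γ ![frame 0, frame 2] := by
  rw [← I_smul_frame_zero, ← I_smul_frame_two, h11]

/-- Type `(1,1)` in the frame: `γ(f₀, f₃) = -γ(f₁, f₂)` (`γ(if₀, if₃) = γ(f₁, -f₂)`). [cite: Zucker1977, Appendix B Lemma p. 207] -/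
theorem apply_frame_zero_three_eq (h11 : ∀ u v : EuclideanSpace ℂ (Fin 2), γ ![I • u, I • v] = γ ![u, v]) :
    γ ![frame 0, frame 3] = -γ ![frame 1, frame 2] := by
  rw [← h11 (frame 0) (frame 3), I_smul_frame_zero, I_smul_frame_three, ctf_neg_right]

/-- **Zucker's Proposition, cohomology side**: a RATIONAL `2`-form of type `(1,1)` on `T₀ = ℂ²/L₀` has no
`dz ∧ dz̄` and no `dw ∧ dw̄` component: `γ(f₀, f₁) = 0` and `γ(f₂, f₃) = 0` (so `H^{1,1} ∩ H²(T₀, ℚ)` lies in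
`ℝ Re(dz∧dw̄) ⊕ ℝ Im(dz∧dw̄)`, on which `J^* = -1`). Proof: the periods `γ(v₁,Jv₁) = a - b`,
`γ(v₂,Jv₂) = 2a - 3b`, `γ(v₁,Jv₂) + γ(v₂,Jv₁) = 2√2a - 2√3b` are rational.
[cite: Zucker1977, Appendix B Proposition p. 207] -/
theorem apply_frame_eq_zero_of_rational (h11 : ∀ u v : EuclideanSpace ℂ (Fin 2), γ ![I • u, I • v] = γ ![u, v])
    (hγ : γ ∈ rationalForms skewPeriodL2 2) :
    γ ![frame 0, frame 1] = 0 ∧ γ ![frame 2, frame 3] = 0 := by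
  have h03 := apply_frame_zero_three_eq h11
  obtain ⟨q₁, hq₁⟩ := exists_rat_eq_apply_single hγ 0 2
  obtain ⟨q₂, hq₂⟩ := exists_rat_eq_apply_single hγ 1 3
  obtain ⟨q₃, hq₃⟩ := exists_rat_eq_apply_single hγ 0 3
  obtain ⟨q₄, hq₄⟩ := exists_rat_eq_apply_single hγ 1 2
  rw [apply_single_zero_two, h03] at hq₁
  rw [apply_single_one_three, h03] at hq₂
  rw [apply_single_zero_three, h03] at hq₃
  rw [apply_single_one_two, h03] at hq₄
  set a := γ ![frame 0, frame 1] with ha_def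
  set b := γ ![frame 2, frame 3] with hb_def
  -- solve the two rational equations
  have ha : a = ((3 * q₁ - q₂ : ℚ) : ℂ) := by
    push_cast; linear_combination hq₂ - 3 * hq₁
  have hb : b = ((2 * q₁ - q₂ : ℚ) : ℂ) := by
    push_cast; linear_combination hq₂ - 2 * hq₁
  -- the irrational one
  have hsum : ((q₃ + q₄ : ℚ) : ℂ) = 2 * (Real.sqrt 2 : ℝ) * a - 2 * (Real.sqrt 3 : ℝ) * b := by
    push_cast; linear_combination hq₃ + hq₄
  rw [ha, hb] at hsum
  have hreal : ((2 * (3 * q₁ - q₂) : ℚ) : ℝ) * Real.sqrt 2 - ((2 * (2 * q₁ - q₂) : ℚ) : ℝ) * Real.sqrt 3 =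
      ((q₃ + q₄ : ℚ) : ℝ) := by
    apply Complex.ofReal_injective
    push_cast at hsum ⊢
    linear_combination -hsum
  obtain ⟨h1, h2⟩ := eq_zero_of_rat_mul_sqrt_two_sub_rat_mul_sqrt_three hreal
  have h1' : (3 * q₁ - q₂ : ℚ) = 0 := by linarith
  have h2' : (2 * q₁ - q₂ : ℚ) = 0 := by linarith
  refine ⟨?_, ?_⟩
  · rw [ha, h1', Rat.cast_zero]
  · rw [hb, h2', Rat.cast_zero]

/-! ### §3 An integral `(1,1)`-class which is non-negative on complex lines vanishes -/

/-- **A rational `(1,1)`-form on `T₀` which is non-negative on every complex line is zero**: by §2 only the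
coefficients `c = γ(f₀,f₂) = γ(f₁,f₃)` and `d = γ(f₀,f₃) = -γ(f₁,f₂)` survive, and `γ(v, iv)` takes the
values `∓2d` at `v = f₀ ± f₂` and `±2c` at `v = f₁ + f₂`, `f₀ + f₃`. [cite: Zucker1977, Appendix B Theorem p. 208] -/
theorem eq_zero_of_rational_of_nonneg (h11 : ∀ u v : EuclideanSpace ℂ (Fin 2), γ ![I • u, I • v] = γ ![u, v])
    (hγ : γ ∈ rationalForms skewPeriodL2 2) (hpos : ∀ u : EuclideanSpace ℂ (Fin 2), 0 ≤ γ ![u, I • u]) :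
    γ = 0 := by
  obtain ⟨ha, hb⟩ := apply_frame_eq_zero_of_rational h11 hγ
  have h13 := apply_frame_one_three_eq h11
  have h03 := apply_frame_zero_three_eq h11
  -- the four test vectors
  have v₁ : γ ![frame 0 + frame 2, I • (frame 0 + frame 2)] = -(2 * γ ![frame 1, frame 2]) := by
    rw [smul_add, I_smul_frame_zero, I_smul_frame_two, ctf_add_left, ctf_add_right, ctf_add_right, ha, hb, h03,
      ctf_swap γ (frame 2) (frame 1)]
    ring
  have v₂ : γ ![frame 0 - frame 2, I • (frame 0 - frame 2)] = 2 * γ ![frame 1, frame 2] := by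
    rw [smul_sub, I_smul_frame_zero, I_smul_frame_two, ctf_sub_left, ctf_sub_right, ctf_sub_right, ha, hb, h03,
      ctf_swap γ (frame 2) (frame 1)]
    ring
  have v₃ : γ ![frame 1 + frame 2, I • (frame 1 + frame 2)] = 2 * γ ![frame 0, frame 2] := by
    rw [smul_add, I_smul_frame_one, I_smul_frame_two, ctf_add_left, ctf_add_right, ctf_add_right, ctf_neg_right,
      ctf_neg_right, h13, hb, ctf_swap γ (frame 1) (frame 0), ha, ctf_swap γ (frame 2) (frame 0)]
    ring
  have v₄ : γ ![frame 0 + frame 3, I • (frame 0 + frame 3)] = -(2 * γ ![frame 0, frame 2]) := by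
    rw [smul_add, I_smul_frame_zero, I_smul_frame_three, ctf_add_left, ctf_add_right, ctf_add_right, ctf_neg_right,
      ctf_neg_right, ha, ctf_swap γ (frame 3) (frame 1), h13, ctf_swap γ (frame 3) (frame 2), hb]
    ring
  have hp₁ := hpos (frame 0 + frame 2)
  have hp₂ := hpos (frame 0 - frame 2)
  have hp₃ := hpos (frame 1 + frame 2)
  have hp₄ := hpos (frame 0 + frame 3)
  rw [v₁] at hp₁
  rw [v₂] at hp₂
  rw [v₃] at hp₃
  rw [v₄] at hp₄
  have h12 : γ ![frame 1, frame 2] = 0 := by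
    have e : 2 * γ ![frame 1, frame 2] = 0 := le_antisymm (neg_nonneg.1 hp₁) hp₂
    simpa using e
  have h02 : γ ![frame 0, frame 2] = 0 := by
    have e : 2 * γ ![frame 0, frame 2] = 0 := le_antisymm (neg_nonneg.1 hp₄) hp₃
    simpa using e
  refine ctf_eq_zero_of_frame ha h02 ?_ h12 ?_ hb
  · rw [h03, h12, neg_zero]
  · rw [h13, h02]

end Proposition

/-- The real `2`-frame of a complex `1`-frame is `(v, iv)`. [folklore] -/
private theorem complexFrame_one {V : Type*} [NormedAddCommGroup V] [InnerProductSpace ℂ V] (v : Fin 1 → V) :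
    complexFrame v = ![v 0, I • v 0] := by
  funext i; fin_cases i <;> simp [complexFrame]

/-- **An integral class of type `(1,1)` on `T₀` which is non-negative on every complex line
(`γ(v, iv) ≥ 0`) is zero** — the cohomological half of "no effective analytic cycle can be homologous
to zero on a compact Kähler manifold" combined with `J^* = -1` on `H^{1,1} ∩ H²(T₀, ℚ)`.
[cite: Zucker1977, Appendix B Theorem p. 208] -/
theorem eq_zero_of_mem_integralHodgeClasses_of_nonneg {γ : EuclideanSpace ℂ (Fin 2) [⋀^Fin (2 * 1)]→L[ℝ] ℂ}
    (hγ : γ ∈ integralHodgeClasses skewPeriodL2 1)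
    (hpos : ∀ v : Fin 1 → EuclideanSpace ℂ (Fin 2), 0 ≤ γ (complexFrame v)) : γ = 0 := by
  rw [mem_integralHodgeClasses_iff] at hγ
  have h11 : ∀ u v : EuclideanSpace ℂ (Fin 2), γ ![I • u, I • v] = γ ![u, v] :=
    apply_I_smul_of_isOfTypeAt_one_one hγ.2
  have hrat : γ ∈ rationalForms skewPeriodL2 2 := mem_rationalForms_of_mem_integralForms skewPeriodL2 hγ.1
  refine eq_zero_of_rational_of_nonneg h11 hrat fun u ↦ ?_
  have h := hpos fun _ ↦ u
  rwa [complexFrame_one] at h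

/-- The same for RATIONAL `(1,1)`-classes (Hodge classes). [cite: Zucker1977, Appendix B Theorem p. 208] -/
theorem eq_zero_of_mem_hodgeClasses_of_nonneg {γ : EuclideanSpace ℂ (Fin 2) [⋀^Fin (2 * 1)]→L[ℝ] ℂ}
    (hγ : γ ∈ hodgeClasses skewPeriodL2 1)
    (hpos : ∀ v : Fin 1 → EuclideanSpace ℂ (Fin 2), 0 ≤ γ (complexFrame v)) : γ = 0 := by
  rw [mem_hodgeClasses_iff] at hγ
  have h11 : ∀ u v : EuclideanSpace ℂ (Fin 2), γ ![I • u, I • v] = γ ![u, v] :=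
    apply_I_smul_of_isOfTypeAt_one_one hγ.2
  refine eq_zero_of_rational_of_nonneg h11 hγ.1 fun u ↦ ?_
  have h := hpos fun _ ↦ u
  rwa [complexFrame_one] at h

/-! ### §4 Zucker's Theorem: `T₀` contains no analytic curve -/

/-- **ZUCKER'S THEOREM for `T₀ = ℂ²/L₀` (Euclidean model)**: the torus `ComplexTorus skewPeriodL2` contains
NO closed analytic subset of pure dimension one. By Lelong/Wirtinger the cycle class `[Z]_e` of such a `Z`
(positively oriented `e`) is an integral `(1,1)`-class, non-negative on complex lines and non-zero (rows
A2-113/A4, `not_hasPureDim_of_forall_nonneg_integralHodgeClass_eq_zero`); §3 says there is none.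
[cite: Zucker1977, Appendix B Theorem p. 208] [cite: Voisin2002KaehlerCounterexample, §1] -/
theorem not_hasPureDim_one_skewPeriodL2 (Z : Set (ComplexTorus skewPeriodL2)) :
    ¬ HasPureDim 𝓘(ℂ, EuclideanSpace ℂ (Fin 2)) Z 1 :=
  not_hasPureDim_of_forall_nonneg_integralHodgeClass_eq_zero skewPeriodL2 (n := 4) (d := 1) (p := 1)
    (Equiv.refl (Fin 4)) (by norm_num) (fun _ hγ hpos ↦ eq_zero_of_mem_integralHodgeClasses_of_nonneg hγ hpos) Z

/-- **ZUCKER'S THEOREM for `T₀ = ℂ²/L₀`** in its original presentation `ComplexTorus Zucker.skewPeriodCLE`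
(model `Fin 2 → ℂ`): `T₀` contains no closed analytic subset of pure dimension one — no analytic curve
("`T` contains no analytic subvarieties of dimension `n`", `n = 1`). Transported from the Euclidean model
along the biholomorphic change of presentation (`HasPureDim.preimage_homeomorph_of_finrank_eq`). This is the
geometric leaf of `Literature.Barriers.HodgeConjecture.Zucker1977_kaehlerTorus_noAnalyticCycles_of_skewLattice`.
[cite: Zucker1977, Appendix B Theorem p. 208] [cite: Voisin2002KaehlerCounterexample, §1] -/
theorem not_hasPureDim_one (Z : Set (ComplexTorus skewPeriodCLE)) : ¬ HasPureDim 𝓘(ℂ, Fin 2 → ℂ) Z 1 :=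
  fun hZ ↦ not_hasPureDim_one_skewPeriodL2 _
    (hZ.preimage_homeomorph_of_finrank_eq presentationHomeomorph mdifferentiable_presentationHomeomorph
      mdifferentiable_presentationHomeomorph_symm finrank_euclideanSpace_eq)

/-- Codimension form: `T₀` contains no closed analytic subset of pure codimension one (no analytic
hypersurface). [cite: Zucker1977, Appendix B Theorem p. 208] -/
theorem not_hasPureCodim_one (Z : Set (ComplexTorus skewPeriodCLE)) : ¬ HasPureCodim 𝓘(ℂ, Fin 2 → ℂ) Z 1 :=
  fun hZ ↦ not_hasPureDim_one Z ⟨1, by simp, hZ⟩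

/-- … and none in the Euclidean model either. [cite: Zucker1977, Appendix B Theorem p. 208] -/
theorem not_hasPureCodim_one_skewPeriodL2 (Z : Set (ComplexTorus skewPeriodL2)) :
    ¬ HasPureCodim 𝓘(ℂ, EuclideanSpace ℂ (Fin 2)) Z 1 :=
  fun hZ ↦ not_hasPureDim_one_skewPeriodL2 Z ⟨1, by rw [finrank_euclideanSpace_fin_two], hZ⟩

/-! ### §5 `A¹(T₀) = 0 ≠ B¹(T₀)`: the cycle-class Lefschetz `(1,1)` fails on `T₀` -/

section AnalyticClasses

variable (e : Fin 4 ≃ Fin 4)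

/-- **`A¹(T₀) = 0`**: the `ℚ`-span of the classes of closed analytic subsets of codimension one of `T₀` is
zero (there are none). [cite: Zucker1977, Appendix B Theorem p. 208] [cite: VoisinHodgeI2002, §11.3.1] -/
theorem analyticClasses_one_eq_bot : analyticClasses skewPeriodL2 e 1 = ⊥ := by
  rw [analyticClasses_eq_span skewPeriodL2 e (d := 1) (p := 1) (by norm_num), Submodule.span_eq_bot]
  rintro γ ⟨Z, hZ, -⟩
  exact absurd hZ (not_hasPureDim_one_skewPeriodL2 Z)

/-- `A¹(T₀)_ℤ = 0` (integral version). [cite: Zucker1977, Appendix B Theorem p. 208] [cite: VoisinHodgeI2002, §11.3.1] -/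
theorem analyticClassesInt_one_eq_bot : analyticClassesInt skewPeriodL2 e 1 = ⊥ := by
  rw [analyticClassesInt, AddSubgroup.closure_eq_bot_iff, Set.subset_singleton_iff]
  rintro γ ⟨d, h, Z, hZ, -⟩
  obtain rfl : d = 1 := by omega
  exact absurd hZ (not_hasPureDim_one_skewPeriodL2 Z)

end AnalyticClasses

/-! ### §5b Mumford's class `ξ`, renormalised: an explicit non-zero rational `(1,1)`-class on `T₀` -/

/-- The coordinate functional `dz_a` on the Euclidean model of `ℂ²`. [cite: Zucker1977, Appendix B p. 207] -/
def dzL (a : Fin 2) : EuclideanSpace ℂ (Fin 2) →L[ℝ] ℂ :=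
  (dz a).comp ((toL2.symm : EuclideanSpace ℂ (Fin 2) →L[ℂ] (Fin 2 → ℂ)).restrictScalars ℝ)

/-- The conjugate coordinate functional `dz̄_a` on the Euclidean model of `ℂ²`. [cite: Zucker1977, Appendix B p. 207] -/
def dzbarL (a : Fin 2) : EuclideanSpace ℂ (Fin 2) →L[ℝ] ℂ :=
  (dzbar a).comp ((toL2.symm : EuclideanSpace ℂ (Fin 2) →L[ℂ] (Fin 2 → ℂ)).restrictScalars ℝ)

/-- `dz_a(u) = u_a`. [cite: Zucker1977, Appendix B p. 207] -/
@[simp] theorem dzL_apply (a : Fin 2) (u : EuclideanSpace ℂ (Fin 2)) : dzL a u = u a := rfl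

/-- `dz̄_a(u) = \overline{u_a}`. [cite: Zucker1977, Appendix B p. 207] -/
@[simp] theorem dzbarL_apply (a : Fin 2) (u : EuclideanSpace ℂ (Fin 2)) : dzbarL a u = conj (u a) := rfl

/-- **Mumford's class `ξ = Re(dz ∧ dw̄)` of Zucker's Lemma (p. 207), renormalised to rational periods on
`L₀`**: `xiForm = (√3 - √2)⁻¹ · (dz ∧ dw̄ + dz̄ ∧ dw) = 2(√3 - √2)⁻¹ Re(dz ∧ dw̄)` (for the lattice `L₀`,
`v₂ = (√2, √3)`, the periods of `Re(dz ∧ dw̄)` are `(√3 - √2)·(1, 0, 0, 0, 0, -1)`).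
[cite: Zucker1977, Appendix B Lemma p. 207] -/
def xiForm : EuclideanSpace ℂ (Fin 2) [⋀^Fin 2]→L[ℝ] ℂ :=
  (Real.sqrt 3 - Real.sqrt 2)⁻¹ • (wedgeForm (dzL 0) (dzbarL 1) + wedgeForm (dzbarL 0) (dzL 1))

/-- Evaluation of `xiForm`. [cite: Zucker1977, Appendix B Lemma p. 207] -/
theorem xiForm_apply (v : Fin 2 → EuclideanSpace ℂ (Fin 2)) :
    xiForm v = ((Real.sqrt 3 - Real.sqrt 2)⁻¹ : ℝ) *
      (v 0 0 * conj (v 1 1) - v 1 0 * conj (v 0 1) + (conj (v 0 0) * v 1 1 - conj (v 1 0) * v 0 1)) := by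
  rw [xiForm, ContinuousAlternatingMap.smul_apply, ContinuousAlternatingMap.add_apply, wedgeForm_apply,
    wedgeForm_apply, Complex.real_smul]
  simp only [dzL_apply, dzbarL_apply]

/-- `xiForm` is of type `(1,1)` (`dz ∧ dw̄` and `dz̄ ∧ dw` are). [cite: Zucker1977, Appendix B Lemma p. 207] -/
theorem isOfTypeAt_one_one_xiForm : IsOfTypeAt 1 1 xiForm := by
  refine ⟨rfl, fun θ v ↦ ?_⟩
  have hexp : cexp ((((1 : ℕ) : ℤ) - (1 : ℕ) : ℤ) * (θ : ℂ) * I) = 1 := by simp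
  have hc : cexp ((θ : ℂ) * I) * conj (cexp ((θ : ℂ) * I)) = 1 := by
    rw [← Complex.exp_conj, map_mul, Complex.conj_ofReal, Complex.conj_I, ← Complex.exp_add]
    ring_nf
    exact Complex.exp_zero
  rw [hexp, one_mul, xiForm_apply, xiForm_apply]
  simp only [PiLp.smul_apply, smul_eq_mul, map_mul]
  linear_combination ((Real.sqrt 3 - Real.sqrt 2)⁻¹ : ℝ) *
    (v 0 0 * conj (v 1 1) - v 1 0 * conj (v 0 1) + (conj (v 0 0) * v 1 1 - conj (v 1 0) * v 0 1)) * hc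

/-- `(√3 - √2)⁻¹ · (√3 - √2) = 1` in `ℂ`. [folklore] -/
private theorem inv_mul_sqrt_sub :
    (((Real.sqrt 3 : ℝ) : ℂ) - (Real.sqrt 2 : ℝ))⁻¹ * ((Real.sqrt 3 : ℝ) - (Real.sqrt 2 : ℝ)) = 1 := by
  rw [← Complex.ofReal_sub, ← Complex.ofReal_inv, ← Complex.ofReal_mul,
    inv_mul_cancel₀ sqrt_three_sub_sqrt_two_ne_zero, Complex.ofReal_one]

/-- **The periods of `xiForm` over the basis bivectors of `L₀`**: `ξ'(λ_j, λ_k)` is the `(j,k)` entry of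
`((0,2,0,0),(-2,0,0,0),(0,0,0,-2),(0,0,2,0))` — rational (indeed integral).
[cite: Zucker1977, Appendix B Lemma p. 207 ("the numbers obtained are all of the form `iᵏ` or `0`")] -/
theorem xiForm_single (j k : Fin 4) :
    xiForm ![skewPeriodL2 (Pi.single j 1), skewPeriodL2 (Pi.single k 1)] =
      (((![![0, 2, 0, 0], ![-2, 0, 0, 0], ![0, 0, 0, -2], ![0, 0, 2, 0]] : Fin 4 → Fin 4 → ℚ) j k : ℚ) : ℂ) := by
  have h := inv_mul_sqrt_sub
  fin_cases j <;> fin_cases k <;>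
    simp [xiForm_apply, Complex.conj_ofReal, Complex.ofReal_inv, Complex.ofReal_sub] <;>
    ring_nf <;> (try simp only [Complex.I_sq]) <;>
    first | ring1 | linear_combination (2 : ℂ) * h | linear_combination (-2 : ℂ) * h

/-- `xiForm` has rational periods: `xiForm ∈ H²(T₀, ℚ)`. [cite: Zucker1977, Appendix B Lemma p. 207] -/
theorem xiForm_mem_rationalForms : xiForm ∈ rationalForms skewPeriodL2 2 := by
  rw [mem_rationalForms_iff_forall_single]
  intro c
  rw [tuple_eq_vecCons (fun j ↦ skewPeriodL2 (Pi.single j 1)) c, xiForm_single]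
  exact ⟨_, by rw [eq_ratCast]⟩

/-- **`xiForm` is a Hodge class of `T₀`**: `ξ' ∈ B¹(T₀) = H²(T₀, ℚ) ∩ H^{1,1}`.
[cite: Zucker1977, Appendix B Lemma and Proposition p. 207] -/
theorem xiForm_mem_hodgeClasses : xiForm ∈ hodgeClasses skewPeriodL2 1 :=
  (mem_hodgeClasses_iff skewPeriodL2).2 ⟨xiForm_mem_rationalForms, isOfTypeAt_one_one_xiForm⟩

/-- `ξ'(f₀, f₂) = 2(√3 - √2)⁻¹`. [cite: Zucker1977, Appendix B Lemma p. 207] -/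
theorem xiForm_frame_zero_two : xiForm ![frame 0, frame 2] = 2 * (((Real.sqrt 3 - Real.sqrt 2)⁻¹ : ℝ) : ℂ) := by
  rw [xiForm_apply]; simp; ring

/-- **`xiForm ≠ 0`.** [cite: Zucker1977, Appendix B Lemma p. 207] -/
theorem xiForm_ne_zero : xiForm ≠ 0 := by
  intro h
  have h1 := xiForm_frame_zero_two
  rw [h, ContinuousAlternatingMap.coe_zero, Pi.zero_apply] at h1
  have h2 : (((Real.sqrt 3 - Real.sqrt 2)⁻¹ : ℝ) : ℂ) ≠ 0 :=
    Complex.ofReal_ne_zero.2 (inv_ne_zero sqrt_three_sub_sqrt_two_ne_zero)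
  exact two_ne_zero (mul_eq_zero.1 h1.symm |>.resolve_right h2)

/-- **`B¹(T₀) ≠ 0`**: `T₀` carries non-zero rational `(1,1)`-classes (Zucker: `H^{1,1}(T) ∩ H²(T, ℚ)` has
rank two). [cite: Zucker1977, Appendix B Proposition p. 207] -/
theorem hodgeClasses_one_ne_bot : hodgeClasses skewPeriodL2 1 ≠ ⊥ := by
  rw [Submodule.ne_bot_iff]
  exact ⟨xiForm, xiForm_mem_hodgeClasses, xiForm_ne_zero⟩

/-- **`A¹(T₀) ≠ B¹(T₀)`: THE CYCLE-CLASS FORM OF LEFSCHETZ `(1,1)` (OF THE HODGE CONJECTURE IN DEGREE 2)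
FAILS FOR THE COMPACT KÄHLER SURFACE `T₀`** — "so the analogue of the Hodge conjecture for Kähler manifolds
is false; in fact even the Lefschetz theorem for divisors is false on general Kähler manifolds". (For every
`2`-dimensional abelian variety `A¹ = B¹`: `IsAbelianVariety.analyticClasses_eq_hodgeClasses_of_finrank_le_two`.)
[cite: Zucker1977, Appendix B Theorem p. 208] [cite: Voisin2002KaehlerCounterexample, §1] -/
theorem analyticClasses_one_ne_hodgeClasses (e : Fin 4 ≃ Fin 4) :
    analyticClasses skewPeriodL2 e 1 ≠ hodgeClasses skewPeriodL2 1 := by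
  rw [analyticClasses_one_eq_bot]
  exact hodgeClasses_one_ne_bot.symm

/-- `A¹(T₀) < B¹(T₀)` (strict inclusion). [cite: Zucker1977, Appendix B Theorem p. 208] -/
theorem analyticClasses_one_lt_hodgeClasses (e : Fin 4 ≃ Fin 4) :
    analyticClasses skewPeriodL2 e 1 < hodgeClasses skewPeriodL2 1 := by
  rw [analyticClasses_one_eq_bot]
  exact bot_lt_iff_ne_bot.2 hodgeClasses_one_ne_bot

/-- The Hodge class `xiForm` is not an analytic class. [cite: Zucker1977, Appendix B Theorem p. 208] -/
theorem xiForm_not_mem_analyticClasses (e : Fin 4 ≃ Fin 4) : xiForm ∉ analyticClasses skewPeriodL2 e 1 := by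
  rw [analyticClasses_one_eq_bot, Submodule.mem_bot]
  exact xiForm_ne_zero

/-! ### §6 Zucker's Proposition in full: `B¹(T₀) = ℚ ξ' ⊕ ℚ η'` has rank two, and `J^* = -1` on it -/

/-- **Mumford's class `η = Im(dz ∧ dw̄)`, renormalised**: `etaForm = (√3 - √2)⁻¹ · (-i)(dz ∧ dw̄ - dz̄ ∧ dw)
= 2(√3 - √2)⁻¹ Im(dz ∧ dw̄)`. [cite: Zucker1977, Appendix B Lemma p. 207] -/
def etaForm : EuclideanSpace ℂ (Fin 2) [⋀^Fin 2]→L[ℝ] ℂ :=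
  (Real.sqrt 3 - Real.sqrt 2)⁻¹ • ((-I) • (wedgeForm (dzL 0) (dzbarL 1) - wedgeForm (dzbarL 0) (dzL 1)))

/-- Evaluation of `etaForm`. [cite: Zucker1977, Appendix B Lemma p. 207] -/
theorem etaForm_apply (v : Fin 2 → EuclideanSpace ℂ (Fin 2)) :
    etaForm v = ((Real.sqrt 3 - Real.sqrt 2)⁻¹ : ℝ) *
      (-I * (v 0 0 * conj (v 1 1) - v 1 0 * conj (v 0 1) - (conj (v 0 0) * v 1 1 - conj (v 1 0) * v 0 1))) := by
  rw [etaForm, ContinuousAlternatingMap.smul_apply, ContinuousAlternatingMap.smul_apply,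
    ContinuousAlternatingMap.sub_apply, wedgeForm_apply, wedgeForm_apply, Complex.real_smul, smul_eq_mul]
  simp only [dzL_apply, dzbarL_apply]

/-- `etaForm` is of type `(1,1)`. [cite: Zucker1977, Appendix B Lemma p. 207] -/
theorem isOfTypeAt_one_one_etaForm : IsOfTypeAt 1 1 etaForm := by
  refine ⟨rfl, fun θ v ↦ ?_⟩
  have hexp : cexp ((((1 : ℕ) : ℤ) - (1 : ℕ) : ℤ) * (θ : ℂ) * I) = 1 := by simp
  have hc : cexp ((θ : ℂ) * I) * conj (cexp ((θ : ℂ) * I)) = 1 := by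
    rw [← Complex.exp_conj, map_mul, Complex.conj_ofReal, Complex.conj_I, ← Complex.exp_add]
    ring_nf
    exact Complex.exp_zero
  rw [hexp, one_mul, etaForm_apply, etaForm_apply]
  simp only [PiLp.smul_apply, smul_eq_mul, map_mul]
  linear_combination ((Real.sqrt 3 - Real.sqrt 2)⁻¹ : ℝ) * (-I) *
    (v 0 0 * conj (v 1 1) - v 1 0 * conj (v 0 1) - (conj (v 0 0) * v 1 1 - conj (v 1 0) * v 0 1)) * hc

/-- **The periods of `etaForm` over the basis bivectors of `L₀`**: the `(j,k)` entry of
`((0,0,0,2),(0,0,-2,0),(0,2,0,0),(-2,0,0,0))`. [cite: Zucker1977, Appendix B Lemma p. 207] -/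
theorem etaForm_single (j k : Fin 4) :
    etaForm ![skewPeriodL2 (Pi.single j 1), skewPeriodL2 (Pi.single k 1)] =
      (((![![0, 0, 0, 2], ![0, 0, -2, 0], ![0, 2, 0, 0], ![-2, 0, 0, 0]] : Fin 4 → Fin 4 → ℚ) j k : ℚ) : ℂ) := by
  have h := inv_mul_sqrt_sub
  fin_cases j <;> fin_cases k <;>
    simp [etaForm_apply, Complex.conj_ofReal, Complex.ofReal_inv, Complex.ofReal_sub, -mul_eq_zero] <;>
    ring_nf <;> (try simp only [Complex.I_sq]) <;>
    first | ring1 | linear_combination (2 : ℂ) * h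

/-- `etaForm` has rational periods. [cite: Zucker1977, Appendix B Lemma p. 207] -/
theorem etaForm_mem_rationalForms : etaForm ∈ rationalForms skewPeriodL2 2 := by
  rw [mem_rationalForms_iff_forall_single]
  intro c
  rw [tuple_eq_vecCons (fun j ↦ skewPeriodL2 (Pi.single j 1)) c, etaForm_single]
  exact ⟨_, by rw [eq_ratCast]⟩

/-- **`etaForm` is a Hodge class of `T₀`.** [cite: Zucker1977, Appendix B Lemma and Proposition p. 207] -/
theorem etaForm_mem_hodgeClasses : etaForm ∈ hodgeClasses skewPeriodL2 1 :=
  (mem_hodgeClasses_iff skewPeriodL2).2 ⟨etaForm_mem_rationalForms, isOfTypeAt_one_one_etaForm⟩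

section RankTwo

variable {γ : EuclideanSpace ℂ (Fin 2) [⋀^Fin 2]→L[ℝ] ℂ}

/-- The period `γ(v₁, v₂)` in the frame: `(√3 - √2) γ(f₀, f₂)`. [cite: Zucker1977, Appendix B p. 207] -/
theorem apply_single_zero_one :
    γ ![skewPeriodL2 (Pi.single 0 1), skewPeriodL2 (Pi.single 1 1)] =
      ((Real.sqrt 3 : ℝ) - (Real.sqrt 2 : ℝ)) * γ ![frame 0, frame 2] := by
  rw [skewPeriodL2_single_zero, skewPeriodL2_single_one, ctf_expand, ctf_self, ctf_self,
    ctf_swap γ (frame 2) (frame 0)]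
  push_cast; ring

/-- **A Hodge class of `T₀` is determined by its two periods `γ(v₁, v₂)` and `γ(v₁, Jv₂)`**: if both
vanish, `γ = 0` (by §2, `a = b = 0`; the two periods are `(√3 - √2)c` and `(√2 - √3)d`).
[cite: Zucker1977, Appendix B Proposition p. 207] -/
theorem eq_zero_of_mem_hodgeClasses_of_periods {γ : EuclideanSpace ℂ (Fin 2) [⋀^Fin (2 * 1)]→L[ℝ] ℂ}
    (hγ : γ ∈ hodgeClasses skewPeriodL2 1)
    (h01 : γ ![skewPeriodL2 (Pi.single 0 1), skewPeriodL2 (Pi.single 1 1)] = 0)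
    (h03 : γ ![skewPeriodL2 (Pi.single 0 1), skewPeriodL2 (Pi.single 3 1)] = 0) : γ = 0 := by
  rw [mem_hodgeClasses_iff] at hγ
  have h11 : ∀ u v : EuclideanSpace ℂ (Fin 2), γ ![I • u, I • v] = γ ![u, v] :=
    apply_I_smul_of_isOfTypeAt_one_one hγ.2
  obtain ⟨ha, hb⟩ := apply_frame_eq_zero_of_rational (γ := γ) h11 hγ.1
  have h13 := apply_frame_one_three_eq (γ := γ) h11
  have h03' := apply_frame_zero_three_eq (γ := γ) h11
  have hne : ((Real.sqrt 3 : ℝ) : ℂ) - (Real.sqrt 2 : ℝ) ≠ 0 := by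
    rw [← Complex.ofReal_sub]; exact Complex.ofReal_ne_zero.2 sqrt_three_sub_sqrt_two_ne_zero
  rw [apply_single_zero_one (γ := γ)] at h01
  have h02 : γ ![frame 0, frame 2] = 0 := (mul_eq_zero.1 h01).resolve_left hne
  rw [apply_single_zero_three (γ := γ), ha, hb, h03'] at h03
  have h12 : γ ![frame 1, frame 2] = 0 := by
    have e : (((Real.sqrt 3 : ℝ) : ℂ) - (Real.sqrt 2 : ℝ)) * γ ![frame 1, frame 2] = 0 := by
      linear_combination h03
    exact (mul_eq_zero.1 e).resolve_left hne
  refine ctf_eq_zero_of_frame ha h02 ?_ h12 ?_ hb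
  · rw [h03', h12, neg_zero]
  · rw [h13, h02]

/-- **ZUCKER'S PROPOSITION (p. 207), cohomology side: `H^{1,1}(T₀) ∩ H²(T₀, ℚ) = ℚ ξ' ⊕ ℚ η'`** — every
rational `(1,1)`-class of `T₀` is the combination `(γ(v₁,v₂)/2) ξ' + (γ(v₁,Jv₂)/2) η'` of Mumford's
renormalised classes. [cite: Zucker1977, Appendix B Proposition p. 207] -/
theorem hodgeClasses_one_eq_span :
    hodgeClasses skewPeriodL2 1 = Submodule.span ℚ (Set.range ![xiForm, etaForm]) := by
  refine le_antisymm (fun γ hγ ↦ ?_) ?_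
  · obtain ⟨q₁, hq₁⟩ := exists_rat_eq_apply_single ((mem_hodgeClasses_iff skewPeriodL2).1 hγ).1 0 1
    obtain ⟨q₃, hq₃⟩ := exists_rat_eq_apply_single ((mem_hodgeClasses_iff skewPeriodL2).1 hγ).1 0 3
    have hxi : xiForm ∈ Submodule.span ℚ (Set.range ![xiForm, etaForm]) :=
      Submodule.subset_span ⟨0, rfl⟩
    have heta : etaForm ∈ Submodule.span ℚ (Set.range ![xiForm, etaForm]) :=
      Submodule.subset_span ⟨1, rfl⟩
    -- the four table entries used
    have t₁ : (((![![0, 2, 0, 0], ![-2, 0, 0, 0], ![0, 0, 0, -2], ![0, 0, 2, 0]] : Fin 4 → Fin 4 → ℚ) 0 1 : ℚ) : ℂ)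
        = 2 := by simp
    have t₂ : (((![![0, 0, 0, 2], ![0, 0, -2, 0], ![0, 2, 0, 0], ![-2, 0, 0, 0]] : Fin 4 → Fin 4 → ℚ) 0 1 : ℚ) : ℂ)
        = 0 := by simp
    have t₃ : (((![![0, 2, 0, 0], ![-2, 0, 0, 0], ![0, 0, 0, -2], ![0, 0, 2, 0]] : Fin 4 → Fin 4 → ℚ) 0 3 : ℚ) : ℂ)
        = 0 := by simp
    have t₄ : (((![![0, 0, 0, 2], ![0, 0, -2, 0], ![0, 2, 0, 0], ![-2, 0, 0, 0]] : Fin 4 → Fin 4 → ℚ) 0 3 : ℚ) : ℂ)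
        = 2 := by simp
    -- `γ - (q₁/2) ξ' - (q₃/2) η'` is a Hodge class with vanishing periods, hence zero
    set δ : EuclideanSpace ℂ (Fin 2) [⋀^Fin 2]→L[ℝ] ℂ := γ - (q₁ / 2 : ℚ) • xiForm - (q₃ / 2 : ℚ) • etaForm
      with hδ_def
    have hδ : δ ∈ hodgeClasses skewPeriodL2 1 :=
      Submodule.sub_mem _ (Submodule.sub_mem _ hγ (Submodule.smul_mem _ _ xiForm_mem_hodgeClasses))
        (Submodule.smul_mem _ _ etaForm_mem_hodgeClasses)
    have e₁ : δ ![skewPeriodL2 (Pi.single 0 1), skewPeriodL2 (Pi.single 1 1)] = 0 := by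
      rw [hδ_def, ContinuousAlternatingMap.sub_apply, ContinuousAlternatingMap.sub_apply,
        ← Rat.cast_smul_eq_qsmul ℂ, ← Rat.cast_smul_eq_qsmul ℂ, ContinuousAlternatingMap.smul_apply,
        ContinuousAlternatingMap.smul_apply, xiForm_single, etaForm_single, ← hq₁, smul_eq_mul, smul_eq_mul, t₁, t₂,
        Rat.cast_div, Rat.cast_ofNat]
      ring
    have e₃ : δ ![skewPeriodL2 (Pi.single 0 1), skewPeriodL2 (Pi.single 3 1)] = 0 := by
      rw [hδ_def, ContinuousAlternatingMap.sub_apply, ContinuousAlternatingMap.sub_apply,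
        ← Rat.cast_smul_eq_qsmul ℂ, ← Rat.cast_smul_eq_qsmul ℂ, ContinuousAlternatingMap.smul_apply,
        ContinuousAlternatingMap.smul_apply, xiForm_single, etaForm_single, ← hq₃, smul_eq_mul, smul_eq_mul, t₃, t₄,
        Rat.cast_div, Rat.cast_div, Rat.cast_ofNat]
      ring
    have hδ0 : δ = 0 := eq_zero_of_mem_hodgeClasses_of_periods hδ e₁ e₃
    have hγeq : γ = (q₁ / 2 : ℚ) • xiForm + (q₃ / 2 : ℚ) • etaForm := by
      have : γ - (q₁ / 2 : ℚ) • xiForm - (q₃ / 2 : ℚ) • etaForm = 0 := hδ0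
      rw [sub_sub, sub_eq_zero] at this
      exact this
    rw [hγeq]
    exact Submodule.add_mem _ (Submodule.smul_mem _ _ hxi) (Submodule.smul_mem _ _ heta)
  · rw [Submodule.span_le]
    rintro _ ⟨i, rfl⟩
    fin_cases i
    · exact xiForm_mem_hodgeClasses
    · exact etaForm_mem_hodgeClasses

/-- `ξ'` and `η'` are linearly independent over `ℚ` (periods `(2, 0)` and `(0, 2)` over `v₁ ∧ v₂`,
`v₁ ∧ Jv₂`). [cite: Zucker1977, Appendix B Proposition p. 207] -/
theorem linearIndependent_xiForm_etaForm : LinearIndependent ℚ ![xiForm, etaForm] := by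
  rw [LinearIndependent.pair_iff]
  intro s t hst
  have e₁ := congrArg (fun γ : EuclideanSpace ℂ (Fin 2) [⋀^Fin 2]→L[ℝ] ℂ ↦
    γ ![skewPeriodL2 (Pi.single 0 1), skewPeriodL2 (Pi.single 1 1)]) hst
  have e₃ := congrArg (fun γ : EuclideanSpace ℂ (Fin 2) [⋀^Fin 2]→L[ℝ] ℂ ↦
    γ ![skewPeriodL2 (Pi.single 0 1), skewPeriodL2 (Pi.single 3 1)]) hst
  simp only [ContinuousAlternatingMap.add_apply, ← Rat.cast_smul_eq_qsmul ℂ, ContinuousAlternatingMap.smul_apply,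
    xiForm_single, etaForm_single, smul_eq_mul, ContinuousAlternatingMap.coe_zero, Pi.zero_apply] at e₁ e₃
  simp at e₁ e₃
  exact ⟨by exact_mod_cast e₁, by exact_mod_cast e₃⟩

/-- **`H^{1,1}(T₀) ∩ H²(T₀, ℚ)` HAS RANK TWO** ("For general `M`, the two classes `ξ` and `η` generate
`H^{n,n}(T, ℤ)`" — here over `ℚ`, for the explicit `L₀`). [cite: Zucker1977, Appendix B Proposition p. 207] -/
theorem finrank_hodgeClasses_one : finrank ℚ (hodgeClasses skewPeriodL2 1) = 2 := by
  rw [hodgeClasses_one_eq_span, finrank_span_eq_card linearIndependent_xiForm_etaForm, Fintype.card_fin]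

/-- Zucker's operator `J(z, w) = (iz, -iw)` on the Euclidean model of `ℂ²`. [cite: Zucker1977, Appendix B p. 207] -/
def JL : EuclideanSpace ℂ (Fin 2) →L[ℂ] EuclideanSpace ℂ (Fin 2) :=
  (toL2 : (Fin 2 → ℂ) →L[ℂ] EuclideanSpace ℂ (Fin 2)).comp
    (J.comp (toL2.symm : EuclideanSpace ℂ (Fin 2) →L[ℂ] (Fin 2 → ℂ)))

/-- `(JL u)_0 = i u_0`. [cite: Zucker1977, Appendix B p. 207] -/
@[simp] theorem JL_apply_zero (u : EuclideanSpace ℂ (Fin 2)) : JL u 0 = I * u 0 := by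
  show J (toL2.symm u) 0 = I * u 0
  rw [J_apply]; rfl

/-- `(JL u)_1 = -i u_1`. [cite: Zucker1977, Appendix B p. 207] -/
@[simp] theorem JL_apply_one (u : EuclideanSpace ℂ (Fin 2)) : JL u 1 = -I * u 1 := by
  show J (toL2.symm u) 1 = -I * u 1
  rw [J_apply]; rfl

/-- `JL` is the analytic representation of the automorphism `ρ(squareMatrix)` of `T₀` in the Euclidean
presentation: `skewPeriodL2 ∘ A = JL ∘ skewPeriodL2` (`JL₀ = L₀`). [cite: Zucker1977, Appendix B p. 207] -/
theorem skewPeriodL2_mulVec (x : Fin 4 → ℝ) :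
    skewPeriodL2 ((squareMatrix.map (Int.cast : ℤ → ℝ)).mulVec x) = JL (skewPeriodL2 x) := by
  rw [skewPeriodL2_apply, skewPeriodL2_apply, skewPeriod_mulVec]
  show toL2 (J (skewPeriod x)) = toL2 (J (toL2.symm (toL2 (skewPeriod x))))
  rw [ContinuousLinearEquiv.symm_apply_apply]

/-- `J^*ξ' = -ξ'`. [cite: Zucker1977, Appendix B Lemma p. 207 ("`J^*ω = -ω`")] -/
theorem xiForm_JL (u v : EuclideanSpace ℂ (Fin 2)) : xiForm ![JL u, JL v] = -xiForm ![u, v] := by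
  rw [xiForm_apply, xiForm_apply]
  simp only [Matrix.cons_val_zero, Matrix.cons_val_one, JL_apply_zero, JL_apply_one, map_mul, map_neg,
    Complex.conj_I]
  have hI : I * I = -1 := Complex.I_mul_I
  linear_combination (((Real.sqrt 3 - Real.sqrt 2)⁻¹ : ℝ) : ℂ) *
    (u 0 * conj (v 1) - v 0 * conj (u 1) + conj (u 0) * v 1 - conj (v 0) * u 1) * hI

/-- `J^*η' = -η'`. [cite: Zucker1977, Appendix B Lemma p. 207 ("`J^*ω = -ω`")] -/
theorem etaForm_JL (u v : EuclideanSpace ℂ (Fin 2)) : etaForm ![JL u, JL v] = -etaForm ![u, v] := by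
  rw [etaForm_apply, etaForm_apply]
  simp only [Matrix.cons_val_zero, Matrix.cons_val_one, JL_apply_zero, JL_apply_one, map_mul, map_neg,
    Complex.conj_I]
  have hI : I * I = -1 := Complex.I_mul_I
  linear_combination (((Real.sqrt 3 - Real.sqrt 2)⁻¹ : ℝ) : ℂ) * (-I) *
    (u 0 * conj (v 1) - v 0 * conj (u 1) - conj (u 0) * v 1 + conj (v 0) * u 1) * hI

/-- **ZUCKER'S MECHANISM `J^*β = -β` FOR EVERY `β ∈ H^{1,1}(T₀) ∩ H²(T₀, ℚ)`** (cohomology side; the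
homology side is `Zucker.skew_latticePairing_comp_J`): so an effective analytic cycle `Z` with class `β`
would give `[Z + J⁻¹Z] = β + J^*β = 0`. [cite: Zucker1977, Appendix B Theorem p. 208] -/
theorem apply_JL_of_mem_hodgeClasses {γ : EuclideanSpace ℂ (Fin 2) [⋀^Fin (2 * 1)]→L[ℝ] ℂ}
    (hγ : γ ∈ hodgeClasses skewPeriodL2 1) (u v : EuclideanSpace ℂ (Fin 2)) :
    γ ![JL u, JL v] = -γ ![u, v] := by
  rw [hodgeClasses_one_eq_span] at hγ
  induction hγ using Submodule.span_induction with
  | mem x hx =>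
    obtain ⟨i, rfl⟩ := hx
    fin_cases i
    · exact xiForm_JL u v
    · exact etaForm_JL u v
  | zero => simp
  | add x y _ _ hx hy =>
    rw [ContinuousAlternatingMap.add_apply, ContinuousAlternatingMap.add_apply, hx, hy, neg_add]
  | smul q x _ hx =>
    rw [ContinuousAlternatingMap.smul_apply, ContinuousAlternatingMap.smul_apply, hx, smul_neg]

end RankTwo

end Zucker

end Literature.Geometry.Kaehler

end
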